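import Mathlib
import Literature.Analysis.TotalPositivity.MultiplyPositiveProofs
import Literature.NumberTheory.LFunctions.WeilConjecturesFunctionalEquationLowDimProofs

/-!
# Descartes' rule of signs: sign-variation patterns, parity, sign rules, Obreschkoff–Schoenberg

First half of the Literature anchor for the engines' `cap.roots.vca` / `cap.roots.signcert`
(the bisection tree, the Descartes test polynomial and the theorem of three circles are in the
companion file `DescartesRootIsolation.lean`, which imports this one).  HONEST FRAMING: the
engines are shared numerical code serving client cells; rigour lives in the verifiers; this file
certifies the mathematics the code relies on, not any run of the code.

## Content and sources (statements checked against the cited pages of `BasuPollackRoy2006`,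
Basu–Pollack–Roy, *Algorithms in Real Algebraic Geometry*, 2nd ed.)

* Notation 2.32 (`Var`) — elementary sign patterns of a coefficient sequence: all `≥ 0` ⇒
  `Var = 0`; `(≤0,…,≤0,≥0,…,≥0)` ⇒ `Var = 1`; `Var(X^k P) = Var(P)`; parity of `Var` =
  sign of `lead · const` (`even_signVariations_iff`).
* Thm. 2.33 [Descartes' law of signs] "Var(P) ≥ pos(P) and the difference is even": Mathlib has
  the inequality (`Polynomial.roots_countP_pos_le_signVariations`); the parity half is
  `signVariations_eq_countP_add_two_mul`, with the leaf rules `Var = 0 ⇒ no positive root`,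
  `Var = 1 ⇒ exactly one positive root, simple`.
* Prop. 2.20 "P does not vanish in (a,b) ⇒ constant sign", Prop. 2.21 "sign of P to the right
  of a root r of multiplicity μ is sign P^(μ)(r), to the left sign (−1)^μ P^(μ)(r)": the
  refinement end-point rule and the sign certificate below.
* Lemma 10.3 (reciprocal polynomial `X^p P(1/X)`), Prop. 10.27: roots of `Polynomial.reverse`.
* Notation 10.1 / Lemma 10.2 [Cauchy]: the root bound in the `max` form used by cap.
* Prop. 2.39 "all roots of P have non-positive real part ⇒ Var(P) = 0" and Prop. 2.40 / 2.44
  (Obreschkoff): "all roots in the cone 𝓑 = {a + ib : |b| ≤ −√3 a}, x > 0 ⇒ Var((X − x)·P) = 1".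
  DESIGN CHOICE: both are derived from Schoenberg's sector theorem already in the tree,
  `Literature.Analysis.TotalPositivity.schoenberg_sector_pf_holds` (`m = 1`: roots off the open
  right half-plane ⇒ coefficients `PF₁`, i.e. of one sign; `m = 2`: roots off the open sector of
  half-angle `2π/3` ⇒ coefficients `PF₂`, and Obreschkoff's `2 × 2`-minor argument
  (`signVariations_X_sub_C_mul_eq_one_of_pf2`) gives exactly one sign variation) instead of
  BPR's induction on normal polynomials (Lemmas 2.41–2.43).

## Dictionary to `engines/code/cap/roots/vca.py`, `signcert.py` (cap 0.2.24)

* `_signvar` ↔ `Polynomial.signVariations`.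
* `_cauchy_k` (`2^k > 1 + max |c_i / c_n|`) ↔ `abs_lt_of_isRoot` (all roots in `(−2^k, 2^k)`).
* `sign_at_dyadic(S, p, j)` ("sign(Σ c_i p^i 2^{j(n-i)})") ↔ `two_pow_mul_eval_dyadic`,
  `sign_eval_dyadic`.
* `_refine_dyadic`: "sign S(e+) = sign S'(e), sign S(e−) = −sign S'(e) (simple root ⇒
  S'(e) ≠ 0)" ↔ `sign_eval_eq_sign_derivative_of_Ioc`, `sign_eval_eq_neg_sign_derivative_of_Ico`;
  the bisection invariant "slo = sign on (lo, r)" ↔ `mul_eval_pos_of_forall_ne_zero`.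
* `signcert.certify_sign_on_interval`: "if NO root of ODD multiplicity lies in (a, b) then f
  does not change sign on [a, b]" ↔ `mul_eval_nonneg_of_even_rootMultiplicity`; verdict
  `changes` ↔ `exists_mul_eval_neg_of_odd_rootMultiplicity`.

Not here: Budan–Fourier (Thm. 2.35), Sturm sequences (`Literature.Algebra.Polynomial.SturmTheorem`),
the bisection tree and the three circles (companion file).
-/

noncomputable section

open Polynomial
open Literature.NumberTheory.LFunctions.WeilFunctionalEquation (reverse_X_sub_C_eq)

namespace Literature.Algebra.Polynomial.Descartes

/-! ### Sign variations of the coefficient sequence: elementary patterns -/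

/-- `eraseLead` strictly decreases the support. [folklore] -/
private theorem card_support_eraseLead_lt {R : Type*} [Semiring R] {P : R[X]} (hP : P ≠ 0) :
    P.eraseLead.support.card < P.support.card := by
  have h := card_support_eraseLead_add_one hP
  omega

/-- All coefficients `≥ 0` ⇒ no sign variation. [cite: BasuPollackRoy2006, Notation 2.32] -/
theorem signVariations_eq_zero_of_coeff_nonneg {P : ℝ[X]} (h : ∀ n, 0 ≤ P.coeff n) :
    P.signVariations = 0 := by
  induction hc : P.support.card using Nat.strong_induction_on generalizing P with
  | _ c ih =>
    by_cases hP : P = 0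
    · simp [hP]
    rw [signVariations_eq_eraseLead_add_ite hP]
    have hE : ∀ n, 0 ≤ P.eraseLead.coeff n := fun n => by
      rw [eraseLead_coeff]; split_ifs <;> simp [h n]
    rw [ih _ (hc ▸ card_support_eraseLead_lt hP) hE rfl]
    have hlc : 0 < P.leadingCoeff :=
      lt_of_le_of_ne (h _) (Ne.symm (leadingCoeff_ne_zero.mpr hP))
    rw [sign_pos hlc]
    rcases (hE P.eraseLead.natDegree).eq_or_lt with h0 | h0
    · rw [Polynomial.leadingCoeff, ← h0]; simp
    · rw [Polynomial.leadingCoeff, sign_pos h0]; simp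

/-- All coefficients `≤ 0` ⇒ no sign variation. [cite: BasuPollackRoy2006, Notation 2.32] -/
theorem signVariations_eq_zero_of_coeff_nonpos {P : ℝ[X]} (h : ∀ n, P.coeff n ≤ 0) :
    P.signVariations = 0 := by
  rw [← signVariations_neg]
  exact signVariations_eq_zero_of_coeff_nonneg fun n => by simpa using h n

/-- In the sign pattern `(≤ 0, …, ≤ 0, ≥ 0, …)` (ascending degree, threshold `m`) a positive
coefficient forces a positive leading coefficient. [folklore] -/
private theorem leadingCoeff_pos_of_pattern {P : ℝ[X]} (m : ℕ)
    (hlo : ∀ k < m, P.coeff k ≤ 0) (hhi : ∀ k, m ≤ k → 0 ≤ P.coeff k)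
    (hpos : ∃ j, 0 < P.coeff j) : 0 < P.leadingCoeff := by
  obtain ⟨j, hj⟩ := hpos
  have hjm : m ≤ j := by
    by_contra h; exact absurd (hlo j (not_le.mp h)) (not_le.mpr hj)
  have hP : P ≠ 0 := by rintro rfl; simp at hj
  have hjd : j ≤ P.natDegree := le_natDegree_of_ne_zero hj.ne'
  exact lt_of_le_of_ne (hhi _ (hjm.trans hjd)) (Ne.symm (leadingCoeff_ne_zero.mpr hP))

/-- The sign pattern `(≤ 0, …, ≤ 0, ≥ 0, …, ≥ 0)` (in ascending degree) with at least one negative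
and one positive coefficient has exactly one sign variation. [cite: BasuPollackRoy2006, Notation
2.32] -/
theorem signVariations_eq_one_of_pattern {P : ℝ[X]} (m : ℕ)
    (hlo : ∀ k < m, P.coeff k ≤ 0) (hhi : ∀ k, m ≤ k → 0 ≤ P.coeff k)
    (hneg : ∃ i, P.coeff i < 0) (hpos : ∃ j, 0 < P.coeff j) : P.signVariations = 1 := by
  induction hc : P.support.card using Nat.strong_induction_on generalizing P with
  | _ c ih =>
    obtain ⟨i, hi⟩ := hneg
    have hP : P ≠ 0 := by rintro rfl; simp at hi
    have hlead : 0 < P.leadingCoeff := leadingCoeff_pos_of_pattern m hlo hhi hpos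
    have hElo : ∀ k < m, P.eraseLead.coeff k ≤ 0 := fun k hk => by
      rw [eraseLead_coeff]; split_ifs <;> simp [hlo k hk]
    have hEhi : ∀ k, m ≤ k → 0 ≤ P.eraseLead.coeff k := fun k hk => by
      rw [eraseLead_coeff]; split_ifs <;> simp [hhi k hk]
    have hid : i ≠ P.natDegree := by
      rintro rfl; exact absurd hi (not_lt.mpr hlead.le)
    have hEi : P.eraseLead.coeff i < 0 := by rwa [eraseLead_coeff_of_ne _ hid]
    have hE0 : P.eraseLead ≠ 0 := by intro h; rw [h] at hEi; simp at hEi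
    rw [signVariations_eq_eraseLead_add_ite hP, sign_pos hlead]
    by_cases hEpos : ∃ j, 0 < P.eraseLead.coeff j
    · rw [ih _ (hc ▸ card_support_eraseLead_lt hP) hElo hEhi ⟨i, hEi⟩ hEpos rfl,
        sign_pos (leadingCoeff_pos_of_pattern m hElo hEhi hEpos)]
      simp
    · push Not at hEpos
      rw [signVariations_eq_zero_of_coeff_nonpos hEpos]
      have hElead : P.eraseLead.leadingCoeff < 0 :=
        lt_of_le_of_ne (hEpos _) (leadingCoeff_ne_zero.mpr hE0)
      rw [sign_neg hElead]
      simp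

/-- Erasing the leading term commutes with multiplication by `X ^ k`. [folklore] -/
private theorem eraseLead_X_pow_mul (k : ℕ) (P : ℝ[X]) :
    (X ^ k * P).eraseLead = X ^ k * P.eraseLead := by
  by_cases hP : P = 0
  · simp [hP]
  ext i
  rw [eraseLead_coeff, coeff_X_pow_mul', coeff_X_pow_mul', natDegree_X_pow_mul k hP,
    eraseLead_coeff]
  by_cases hki : k ≤ i
  · rw [if_pos hki, if_pos hki]
    by_cases h1 : i = P.natDegree + k
    · rw [if_pos h1, if_pos (by omega)]
    · rw [if_neg h1, if_neg (by omega)]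
  · rw [if_neg hki, if_neg hki]
    split_ifs <;> rfl

/-- Multiplication by `X ^ k` does not change the number of sign variations. [cite:
BasuPollackRoy2006, Notation 2.32] -/
theorem signVariations_X_pow_mul (k : ℕ) (P : ℝ[X]) :
    (X ^ k * P).signVariations = P.signVariations := by
  induction hc : P.support.card using Nat.strong_induction_on generalizing P with
  | _ c ih =>
    by_cases hP : P = 0
    · simp [hP]
    have hXP : X ^ k * P ≠ 0 := mul_ne_zero (pow_ne_zero _ X_ne_zero) hP
    rw [signVariations_eq_eraseLead_add_ite hP, signVariations_eq_eraseLead_add_ite hXP,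
      eraseLead_X_pow_mul, ih _ (hc ▸ card_support_eraseLead_lt hP) _ rfl]
    have h1 : (X ^ k * P).leadingCoeff = P.leadingCoeff := by
      rw [(commute_X_pow P k).eq, leadingCoeff_mul_X_pow]
    have h2 : (X ^ k * P.eraseLead).leadingCoeff = P.eraseLead.leadingCoeff := by
      rw [(commute_X_pow P.eraseLead k).eq, leadingCoeff_mul_X_pow]
    rw [h1, h2]

/-- Multiplication by `X ^ k` on the right does not change the number of sign variations. [cite:
BasuPollackRoy2006, Notation 2.32] -/
theorem signVariations_mul_X_pow (k : ℕ) (P : ℝ[X]) :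
    (P * X ^ k).signVariations = P.signVariations := by
  rw [← (commute_X_pow P k).eq, signVariations_X_pow_mul]

/-- For non-zero reals, `sign a = - sign b` iff `a * b < 0`. [folklore] -/
private theorem sign_eq_neg_sign_iff {a b : ℝ} (ha : a ≠ 0) (hb : b ≠ 0) :
    SignType.sign a = -SignType.sign b ↔ a * b < 0 := by
  rcases ha.lt_or_gt with ha | ha <;> rcases hb.lt_or_gt with hb | hb
  · rw [sign_neg ha, sign_neg hb]
    exact ⟨fun h => absurd h (by decide),
      fun h => absurd h (not_lt.mpr (mul_pos_of_neg_of_neg ha hb).le)⟩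
  · rw [sign_neg ha, sign_pos hb]
    exact ⟨fun _ => mul_neg_of_neg_of_pos ha hb, fun _ => by decide⟩
  · rw [sign_pos ha, sign_neg hb]
    exact ⟨fun _ => mul_neg_of_pos_of_neg ha hb, fun _ => by decide⟩
  · rw [sign_pos ha, sign_pos hb]
    exact ⟨fun h => absurd h (by decide), fun h => absurd h (not_lt.mpr (mul_pos ha hb).le)⟩

/-- **Parity of the number of sign variations**: for a polynomial with non-zero constant
coefficient, `Var(P)` is even iff the leading and the constant coefficient have the same sign.
[cite: BasuPollackRoy2006, Thm. 2.33] -/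
theorem even_signVariations_iff {P : ℝ[X]} (h0 : P.coeff 0 ≠ 0) :
    Even P.signVariations ↔ 0 < P.leadingCoeff * P.coeff 0 := by
  induction hc : P.support.card using Nat.strong_induction_on generalizing P with
  | _ c ih =>
    have hP : P ≠ 0 := by rintro rfl; simp at h0
    by_cases hd : P.natDegree = 0
    · rw [eq_C_of_natDegree_eq_zero hd] at h0 ⊢
      rw [← monomial_zero_left, signVariations_monomial]
      simp only [monomial_zero_left, leadingCoeff_C, coeff_C_zero]
      exact ⟨fun _ => mul_self_pos.mpr (by simpa using h0), fun _ => ⟨0, rfl⟩⟩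
    have hE0c : P.eraseLead.coeff 0 = P.coeff 0 := eraseLead_coeff_of_ne _ (Ne.symm hd)
    have hE0 : P.eraseLead.coeff 0 ≠ 0 := by rwa [hE0c]
    have hE : P.eraseLead ≠ 0 := by intro h; rw [h] at hE0; simp at hE0
    have ihE := ih _ (hc ▸ card_support_eraseLead_lt hP) hE0 rfl
    rw [hE0c] at ihE
    have hlP : P.leadingCoeff ≠ 0 := leadingCoeff_ne_zero.mpr hP
    have hlE : P.eraseLead.leadingCoeff ≠ 0 := leadingCoeff_ne_zero.mpr hE
    rw [signVariations_eq_eraseLead_add_ite hP]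
    by_cases hs : SignType.sign P.leadingCoeff = -SignType.sign P.eraseLead.leadingCoeff
    · rw [if_pos hs, Nat.even_add_one, ihE]
      rw [sign_eq_neg_sign_iff hlP hlE] at hs
      constructor
      · intro h
        have h' : P.eraseLead.leadingCoeff * P.coeff 0 < 0 :=
          lt_of_le_of_ne (not_lt.mp h) (mul_ne_zero hlE h0)
        nlinarith [mul_pos_of_neg_of_neg hs h', sq_nonneg P.eraseLead.leadingCoeff,
          mul_self_pos.mpr hlE]
      · intro h h'
        nlinarith [mul_pos h h', mul_self_pos.mpr h0]
    · rw [if_neg hs, add_zero, ihE]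
      rw [sign_eq_neg_sign_iff hlP hlE, not_lt] at hs
      have hs' : 0 < P.leadingCoeff * P.eraseLead.leadingCoeff :=
        lt_of_le_of_ne hs (Ne.symm (mul_ne_zero hlP hlE))
      constructor
      · intro h
        nlinarith [mul_pos hs' h, mul_self_pos.mpr hlE]
      · intro h
        nlinarith [mul_pos hs' h, mul_self_pos.mpr hlP]

/-! ### Parity of the number of roots to the right of a non-root (BPR Thm 2.33, parity part) -/

/-- A non-zero real polynomial without real roots has everywhere the sign of its leading
coefficient. [cite: BasuPollackRoy2006, Prop. 2.20] -/
theorem leadingCoeff_mul_eval_pos_of_roots_eq_zero {Q : ℝ[X]} (hQ : Q ≠ 0) (hr : Q.roots = 0)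
    (x : ℝ) : 0 < Q.leadingCoeff * Q.eval x := by
  have hnr : ∀ y, Q.eval y ≠ 0 := fun y hy => by
    have : y ∈ Q.roots := (mem_roots hQ).mpr hy
    rw [hr] at this
    exact Multiset.notMem_zero _ this
  have hlc : Q.leadingCoeff ≠ 0 := leadingCoeff_ne_zero.mpr hQ
  by_cases hd : Q.natDegree = 0
  · have hc : Q.leadingCoeff = Q.eval x := by
      rw [eq_C_of_natDegree_eq_zero hd, leadingCoeff_C, eval_C]
    rw [← hc]
    exact mul_self_pos.mpr hlc
  set R : ℝ[X] := C Q.leadingCoeff * Q with hR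
  have hRe : ∀ y, R.eval y = Q.leadingCoeff * Q.eval y := fun y => by simp [hR]
  have hRlc : 0 ≤ R.leadingCoeff := by
    rw [hR, leadingCoeff_mul, leadingCoeff_C]
    exact mul_self_nonneg _
  have hRdeg : 0 < R.degree := by
    rw [hR, degree_C_mul hlc]
    exact natDegree_pos_iff_degree_pos.mp (Nat.pos_of_ne_zero hd)
  have ht := R.tendsto_atTop_of_leadingCoeff_nonneg hRdeg hRlc
  obtain ⟨x₀, hx₀⟩ := (ht.eventually_gt_atTop 0).exists
  by_contra hx
  rw [not_lt, ← hRe] at hx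
  obtain ⟨y, hy⟩ := mem_range_of_exists_le_of_exists_ge R.continuous ⟨x, hx⟩ ⟨x₀, hx₀.le⟩
  have hy' : Q.leadingCoeff * Q.eval y = 0 := by rw [← hRe]; exact hy
  rcases mul_eq_zero.mp hy' with h | h
  · exact hlc h
  · exact hnr y h

/-- Sign of `∏_{a ∈ s} (x - a)`: positive iff the number of `a ∈ s` to the right of `x` is even.
[folklore] -/
private theorem prod_map_sub_pos_iff_even_countP (x : ℝ) (s : Multiset ℝ) (hs : ∀ a ∈ s, a ≠ x) :
    0 < (s.map (fun a => x - a)).prod ↔ Even (s.countP (x < ·)) := by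
  induction s using Multiset.induction_on with
  | empty => simp
  | cons a s ih =>
    have hs' : ∀ b ∈ s, b ≠ x := fun b hb => hs b (Multiset.mem_cons_of_mem hb)
    have hax : a ≠ x := hs a (Multiset.mem_cons_self a s)
    have hne : (s.map (fun a => x - a)).prod ≠ 0 := by
      rw [Ne, Multiset.prod_eq_zero_iff, Multiset.mem_map]
      rintro ⟨b, hb, hb0⟩
      exact hs' b hb (sub_eq_zero.mp hb0).symm
    specialize ih hs'
    rw [Multiset.map_cons, Multiset.prod_cons, Multiset.countP_cons]
    rcases hax.lt_or_gt with h | h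
    · have hna : ¬ x < a := not_lt.mpr h.le
      rw [if_neg hna, add_zero, ← ih]
      have hxa : 0 < x - a := sub_pos.mpr h
      exact ⟨fun h' => pos_of_mul_pos_right h' hxa.le, fun h' => mul_pos hxa h'⟩
    · rw [if_pos h, Nat.even_add_one, ← ih]
      have hxa : x - a < 0 := sub_neg.mpr h
      constructor
      · intro h' h''
        nlinarith
      · intro h'
        exact mul_pos_of_neg_of_neg hxa (lt_of_le_of_ne (not_lt.mp h') hne)

/-- Evaluation of `∏ (X - a)`. [folklore] -/
private theorem eval_multiset_prod_X_sub_C (s : Multiset ℝ) (x : ℝ) :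
    (s.map fun a => X - C a).prod.eval x = (s.map fun a => x - a).prod := by
  rw [eval_multiset_prod, Multiset.map_map]
  congr 1
  exact Multiset.map_congr rfl fun a _ => by simp

/-- **Parity of the root count to the right of a non-root.** For a real polynomial `P` and a point
`x` with `P(x) ≠ 0`, the number of real roots `> x` (with multiplicity) is even iff `P(x)` has the
sign of the leading coefficient. [cite: BasuPollackRoy2006, Prop. 2.21, Thm. 2.33] -/
theorem even_countP_roots_gt_iff {P : ℝ[X]} {x : ℝ} (hx : P.eval x ≠ 0) :
    Even (P.roots.countP (x < ·)) ↔ 0 < P.leadingCoeff * P.eval x := by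
  have hP : P ≠ 0 := by rintro rfl; simp at hx
  obtain ⟨Q, hQP, -, hQr⟩ := exists_prod_multiset_X_sub_C_mul P
  have hQ : Q ≠ 0 := by rintro rfl; rw [mul_zero] at hQP; exact hP hQP.symm
  have hmon := monic_multisetProd_X_sub_C P.roots
  have hlc : P.leadingCoeff = Q.leadingCoeff := by
    rw [← hQP, leadingCoeff_monic_mul hmon]
  have hev : P.eval x = (P.roots.map fun a => x - a).prod * Q.eval x := by
    conv_lhs => rw [← hQP]
    rw [eval_mul, eval_multiset_prod_X_sub_C]
  have hroots : ∀ a ∈ P.roots, a ≠ x := by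
    rintro a ha rfl
    exact hx ((mem_roots hP).mp ha)
  have hQx := leadingCoeff_mul_eval_pos_of_roots_eq_zero hQ hQr x
  rw [← prod_map_sub_pos_iff_even_countP x P.roots hroots, hlc, hev]
  constructor
  · intro h
    have : Q.leadingCoeff * ((P.roots.map fun a => x - a).prod * Q.eval x)
        = (P.roots.map fun a => x - a).prod * (Q.leadingCoeff * Q.eval x) := by ring
    rw [this]
    exact mul_pos h hQx
  · intro h
    have : Q.leadingCoeff * ((P.roots.map fun a => x - a).prod * Q.eval x)
        = (P.roots.map fun a => x - a).prod * (Q.leadingCoeff * Q.eval x) := by ring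
    rw [this] at h
    exact pos_of_mul_pos_left h hQx.le

/-- Special case `x = 0`: the number of positive roots is even iff the leading and the constant
coefficient have the same sign. [cite: BasuPollackRoy2006, Prop. 2.21, Thm. 2.33] -/
theorem even_countP_roots_pos_iff {P : ℝ[X]} (h0 : P.coeff 0 ≠ 0) :
    Even (P.roots.countP (0 < ·)) ↔ 0 < P.leadingCoeff * P.coeff 0 := by
  rw [coeff_zero_eq_eval_zero] at h0 ⊢
  exact even_countP_roots_gt_iff h0

/-- **Descartes' rule of signs, parity part** (BPR Thm 2.33): `Var(P) - pos(P)` is even and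
non-negative, i.e. `Var(P) = pos(P) + 2 j` for some `j`. [cite: BasuPollackRoy2006, Thm. 2.33] -/
theorem signVariations_eq_countP_add_two_mul (P : ℝ[X]) :
    ∃ j : ℕ, P.signVariations = P.roots.countP (0 < ·) + 2 * j := by
  -- reduce to the case `P.coeff 0 ≠ 0` by pulling out the power of `X` dividing `P`
  suffices key : ∀ Q : ℝ[X], Q.coeff 0 ≠ 0 →
      ∃ j : ℕ, Q.signVariations = Q.roots.countP (0 < ·) + 2 * j by
    by_cases hP : P = 0
    · exact ⟨0, by simp [hP]⟩
    have hfac := pow_mul_divByMonic_rootMultiplicity_eq P 0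
    have hev := eval_divByMonic_pow_rootMultiplicity_ne_zero 0 hP
    set k := rootMultiplicity 0 P
    set Q := P /ₘ (X - C 0) ^ k with hQdef
    simp only [map_zero, sub_zero] at hfac hev
    have hQ : Q ≠ 0 := by rintro h; rw [h] at hev; simp at hev
    have hQ0 : Q.coeff 0 ≠ 0 := by rwa [coeff_zero_eq_eval_zero]
    obtain ⟨j, hj⟩ := key Q hQ0
    refine ⟨j, ?_⟩
    rw [← hfac, signVariations_X_pow_mul, hj, roots_mul (hfac.symm ▸ hP), roots_X_pow,
      Multiset.countP_add]
    suffices h : Multiset.countP (fun x : ℝ => 0 < x) {0} = 0 by simp [h]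
    rw [Multiset.countP_eq_zero]
    intro a ha
    rw [Multiset.mem_singleton] at ha
    simp [ha]
  intro Q hQ0
  have hle := Q.roots_countP_pos_le_signVariations
  have hpar : Even Q.signVariations ↔ Even (Q.roots.countP (0 < ·)) := by
    rw [even_signVariations_iff hQ0, even_countP_roots_pos_iff hQ0]
  obtain ⟨j, hj⟩ := (Nat.even_sub hle).mpr hpar
  exact ⟨j, by omega⟩

/-- `Var(P) = 0` ⇒ `P` has no positive root (for `P ≠ 0`). [cite: BasuPollackRoy2006, Thm. 2.33] -/
theorem not_isRoot_of_signVariations_eq_zero {P : ℝ[X]} (hP : P ≠ 0)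
    (hV : P.signVariations = 0) {x : ℝ} (hx : 0 < x) : ¬ P.IsRoot x := by
  intro hr
  have h1 : 0 < P.roots.countP (0 < ·) :=
    Multiset.countP_pos.mpr ⟨x, (mem_roots hP).mpr hr, hx⟩
  have h2 := P.roots_countP_pos_le_signVariations
  omega

/-- `Var(P) = 1` ⇒ `P` has exactly one positive root, and it is simple. [cite: BasuPollackRoy2006,
Thm. 2.33] -/
theorem countP_roots_pos_eq_one_of_signVariations_eq_one {P : ℝ[X]}
    (hV : P.signVariations = 1) : P.roots.countP (0 < ·) = 1 := by
  obtain ⟨j, hj⟩ := signVariations_eq_countP_add_two_mul P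
  omega

/-! ### Reversal `Rec_p` and its roots (BPR Lemma 10.3, Prop. 10.27) -/

section Reverse

variable {K : Type*} [Field K]

/-- Reversal of `1`. [folklore] -/
private theorem reverse_one' : (1 : K[X]).reverse = 1 := by
  rw [← C_1, reverse_C]

/-- `1 - a·X ≠ 0`. [folklore] -/
private theorem one_sub_C_mul_X_ne_zero (a : K) : (1 - C a * X : K[X]) ≠ 0 := by
  intro h
  have := congr_arg (fun p : K[X] => p.coeff 0) h
  simp at this

/-- Roots of `1 - a·X` for `a ≠ 0`. [folklore] -/
private theorem roots_one_sub_C_mul_X {a : K} (ha : a ≠ 0) :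
    (1 - C a * X : K[X]).roots = {a⁻¹} := by
  have : (1 - C a * X : K[X]) = C (-a) * (X - C a⁻¹) := by
    rw [mul_sub, ← C_mul, neg_mul, mul_inv_cancel₀ ha, C_neg, C_neg, C_1]
    ring
  rw [this, roots_C_mul _ (neg_ne_zero.mpr ha), roots_X_sub_C]

/-- Reversal is multiplicative on multiset products (over a field). [folklore] -/
private theorem reverse_multiset_prod (s : Multiset K[X]) :
    s.prod.reverse = (s.map reverse).prod := by
  induction s using Multiset.induction_on with
  | empty => simp [reverse_one']
  | cons p s ih =>
    rw [Multiset.prod_cons, Multiset.map_cons, Multiset.prod_cons, reverse_mul_of_domain, ih]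

/-- A root-free non-zero polynomial has a root-free reversal. [folklore] -/
private theorem roots_reverse_eq_zero_of_roots_eq_zero {Q : K[X]} (hQ : Q ≠ 0) (h : Q.roots = 0) :
    Q.reverse.roots = 0 := by
  refine Multiset.eq_zero_of_forall_notMem fun b hb => ?_
  have hQr : Q.reverse ≠ 0 := fun h' => hQ (reverse_eq_zero.mp h')
  have hb' : Q.reverse.eval b = 0 := (mem_roots hQr).mp hb
  have hb0 : b ≠ 0 := by
    rintro rfl
    rw [← coeff_zero_eq_eval_zero, coeff_zero_reverse] at hb'
    exact leadingCoeff_ne_zero.mpr hQ hb'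
  haveI : Invertible b⁻¹ := invertibleOfNonzero (inv_ne_zero hb0)
  have key := eval₂_reverse_eq_zero_iff (RingHom.id K) b⁻¹ Q
  rw [invOf_eq_inv, inv_inv] at key
  have h2 : Q.eval b⁻¹ = 0 := key.mp hb'
  have : b⁻¹ ∈ Q.roots := (mem_roots hQ).mpr h2
  rw [h] at this
  exact Multiset.notMem_zero _ this

/-- Roots of `∏ (1 - a X)` for non-zero `a`. [folklore] -/
private theorem roots_multiset_prod_one_sub_C_mul_X (s : Multiset K) (hs : ∀ a ∈ s, a ≠ 0) :
    (s.map fun a => (1 - C a * X : K[X])).prod.roots = s.map (·⁻¹) := by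
  induction s using Multiset.induction_on with
  | empty => simp
  | cons a s ih =>
    have ha : a ≠ 0 := hs a (Multiset.mem_cons_self _ _)
    have hs' : ∀ b ∈ s, b ≠ 0 := fun b hb => hs b (Multiset.mem_cons_of_mem hb)
    have hrest : (s.map fun a => (1 - C a * X : K[X])).prod ≠ 0 := by
      refine Multiset.prod_ne_zero ?_
      rw [Multiset.mem_map]
      rintro ⟨b, -, hb⟩
      exact one_sub_C_mul_X_ne_zero b hb
    rw [Multiset.map_cons, Multiset.prod_cons,
      roots_mul (mul_ne_zero (one_sub_C_mul_X_ne_zero a) hrest), roots_one_sub_C_mul_X ha,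
      ih hs', Multiset.map_cons, Multiset.singleton_add]

/-- **Roots of the reversed polynomial** (`P(0) ≠ 0`): they are the inverses of the roots of `P`,
with multiplicity. [cite: BasuPollackRoy2006, Lemma 10.3 (proof), Prop. 10.32 (proof)] -/
theorem roots_reverse {P : K[X]} (h0 : P.coeff 0 ≠ 0) : P.reverse.roots = P.roots.map (·⁻¹) := by
  have hP : P ≠ 0 := by rintro rfl; simp at h0
  obtain ⟨Q, hQP, -, hQr⟩ := exists_prod_multiset_X_sub_C_mul P
  have hQ : Q ≠ 0 := by rintro rfl; rw [mul_zero] at hQP; exact hP hQP.symm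
  have hroots : ∀ a ∈ P.roots, a ≠ 0 := by
    rintro a ha rfl
    exact h0 (by rw [coeff_zero_eq_eval_zero]; exact (mem_roots hP).mp ha)
  have hrev : P.reverse = (P.roots.map fun a => (1 - C a * X : K[X])).prod * Q.reverse := by
    conv_lhs => rw [← hQP]
    rw [reverse_mul_of_domain, reverse_multiset_prod, Multiset.map_map]
    congr 2
    exact Multiset.map_congr rfl fun a _ => reverse_X_sub_C_eq a
  have hne : (P.roots.map fun a => (1 - C a * X : K[X])).prod * Q.reverse ≠ 0 := by
    rw [← hrev]
    exact fun h' => hP (reverse_eq_zero.mp h')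
  rw [hrev, roots_mul hne, roots_multiset_prod_one_sub_C_mul_X _ hroots,
    roots_reverse_eq_zero_of_roots_eq_zero hQ hQr, add_zero]

/-- Roots of the reversed polynomial in general: the inverses of the non-zero roots. [cite:
BasuPollackRoy2006, Lemma 10.3 (proof), Prop. 10.32 (proof)] -/
theorem roots_reverse_of_ne_zero [DecidableEq K] {P : K[X]} (hP : P ≠ 0) :
    P.reverse.roots = (P.roots.filter (· ≠ 0)).map (·⁻¹) := by
  have hfac := pow_mul_divByMonic_rootMultiplicity_eq P 0
  have hev := eval_divByMonic_pow_rootMultiplicity_ne_zero 0 hP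
  set k := rootMultiplicity 0 P
  set Q := P /ₘ (X - C 0) ^ k
  simp only [map_zero, sub_zero] at hfac hev
  have hQ : Q ≠ 0 := by rintro h; rw [h] at hev; simp at hev
  have hQ0 : Q.coeff 0 ≠ 0 := by rwa [coeff_zero_eq_eval_zero]
  rw [← hfac, reverse_X_pow_mul, roots_reverse hQ0, roots_mul (hfac.symm ▸ hP), roots_X_pow,
    Multiset.filter_add, Multiset.filter_eq_nil.mpr, zero_add, Multiset.filter_eq_self.mpr]
  · intro a ha h
    rw [h] at ha
    exact hQ0 (by rw [coeff_zero_eq_eval_zero]; exact (mem_roots hQ).mp ha)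
  · intro a ha
    have := Multiset.mem_of_mem_nsmul ha
    rw [Multiset.mem_singleton] at this
    exact not_not.mpr this

end Reverse

/-! ### Cauchy's root bound in the form used by cap `_cauchy_k` -/

/-- If `|c_i| ≤ M |c_n|` for all `i < n = deg P` then every real root satisfies `|x| < M + 1` (cap
takes `M = max |c_i / c_n|` and the least `k` with `2^k > 1 + M`, so all roots lie in the open
interval `(-2^k, 2^k)`). [cite: BasuPollackRoy2006, Notation 10.1, Lemma 10.2] -/
theorem abs_lt_of_isRoot {P : ℝ[X]} (hP : P ≠ 0) {M : ℝ} (hM0 : 0 ≤ M)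
    (hM : ∀ i < P.natDegree, |P.coeff i| ≤ M * |P.leadingCoeff|) {x : ℝ} (hx : P.IsRoot x) :
    |x| < M + 1 := by
  have h := hx.norm_lt_cauchyBound hP
  have hlc : 0 < ‖P.leadingCoeff‖₊ := by
    rw [nnnorm_pos]
    exact leadingCoeff_ne_zero.mpr hP
  have hsup : (Finset.range P.natDegree).sup (fun i => ‖P.coeff i‖₊) ≤
      M.toNNReal * ‖P.leadingCoeff‖₊ := by
    refine Finset.sup_le fun i hi => ?_
    rw [Finset.mem_range] at hi
    rw [← NNReal.coe_le_coe, NNReal.coe_mul, coe_nnnorm, coe_nnnorm, Real.coe_toNNReal _ hM0,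
      Real.norm_eq_abs, Real.norm_eq_abs]
    exact hM i hi
  have hcb : P.cauchyBound ≤ M.toNNReal + 1 := by
    unfold cauchyBound
    gcongr
    rw [div_le_iff₀ hlc]
    exact hsup
  have := h.trans_le hcb
  rw [← NNReal.coe_lt_coe, coe_nnnorm, Real.norm_eq_abs, NNReal.coe_add, NNReal.coe_one,
    Real.coe_toNNReal _ hM0] at this
  exact this

section Refinement

/-! ### Sign at dyadic points and the refinement end-point rule
(cap `sign_at_dyadic`, `_refine_dyadic`) -/

/-- cap `sign_at_dyadic`: `2^(j n) · S(p / 2^j) = Σ_i c_i p^i 2^(j (n - i))`, an exact integer when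
the `c_i` and `p` are integers. [cite: BasuPollackRoy2006, Algorithm 10.4 (dyadic points)] -/
theorem two_pow_mul_eval_dyadic (S : ℝ[X]) (p : ℝ) (j : ℕ) {n : ℕ} (hn : S.natDegree ≤ n) :
    2 ^ (j * n) * S.eval (p / 2 ^ j) =
      ∑ i ∈ Finset.range (n + 1), S.coeff i * p ^ i * 2 ^ (j * (n - i)) := by
  rw [eval_eq_sum_range' (Nat.lt_succ_of_le hn), Finset.mul_sum]
  refine Finset.sum_congr rfl fun i hi => ?_
  rw [Finset.mem_range] at hi
  have h : j * n = j * (n - i) + j * i := by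
    rw [← mul_add, Nat.sub_add_cancel (by omega)]
  rw [h, pow_add, div_pow, ← pow_mul]
  have h2 : (2 : ℝ) ^ (j * i) ≠ 0 := pow_ne_zero _ two_ne_zero
  field_simp

/-- The sign of `S(p / 2^j)` is the sign of the integer `Σ_i c_i p^i 2^(j (n - i))`. [cite:
BasuPollackRoy2006, Algorithm 10.4 (dyadic points)] -/
theorem sign_eval_dyadic (S : ℝ[X]) (p : ℝ) (j : ℕ) {n : ℕ} (hn : S.natDegree ≤ n) :
    SignType.sign (S.eval (p / 2 ^ j)) =
      SignType.sign (∑ i ∈ Finset.range (n + 1), S.coeff i * p ^ i * 2 ^ (j * (n - i))) := by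
  rw [← two_pow_mul_eval_dyadic S p j hn, sign_mul, sign_pos (pow_pos two_pos _), one_mul]

/-- No root on `[u, v]` ⇒ the same strict sign at `u` and `v`. [cite: BasuPollackRoy2006, Prop.
2.20] -/
theorem mul_eval_pos_of_forall_ne_zero {T : ℝ[X]} {u v : ℝ} (huv : u ≤ v)
    (h : ∀ z ∈ Set.Icc u v, T.eval z ≠ 0) : 0 < T.eval u * T.eval v := by
  by_contra hle
  rw [not_lt] at hle
  have hc : ContinuousOn (fun x => T.eval x) (Set.Icc u v) := T.continuous.continuousOn
  rcases mul_nonpos_iff.mp hle with ⟨h1, h2⟩ | ⟨h1, h2⟩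
  · obtain ⟨z, hz, hz0⟩ := intermediate_value_Icc' huv hc ⟨h2, h1⟩
    exact h z hz hz0
  · obtain ⟨z, hz, hz0⟩ := intermediate_value_Icc huv hc ⟨h1, h2⟩
    exact h z hz hz0

/-- Same strict sign from a positive product. [folklore] -/
private theorem sign_eq_sign_of_mul_pos {a b : ℝ} (h : 0 < a * b) :
    SignType.sign a = SignType.sign b := by
  rcases lt_trichotomy a 0 with ha | rfl | ha
  · rw [sign_neg ha, sign_neg (neg_of_mul_pos_right h ha.le)]
  · simp at h
  · rw [sign_pos ha, sign_pos (pos_of_mul_pos_right h ha.le)]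

/-- **Refinement endpoint rule, right side** (cap `_refine_dyadic`): at a simple root `e` of `S`
with no further root in `(e, t]`, the sign of `S` on `(e, t]` is the sign of `S'(e)`. [cite:
BasuPollackRoy2006, Prop. 2.21] -/
theorem sign_eval_eq_sign_derivative_of_Ioc {S : ℝ[X]} {e t : ℝ} (hS : S.IsRoot e)
    (hS' : S.derivative.eval e ≠ 0) (hno : ∀ z ∈ Set.Ioc e t, S.eval z ≠ 0) {x : ℝ}
    (hx : x ∈ Set.Ioc e t) : SignType.sign (S.eval x) = SignType.sign (S.derivative.eval e) := by
  obtain ⟨T, hT⟩ : ∃ T : ℝ[X], (X - C e) * T = S := ⟨_, mul_divByMonic_eq_iff_isRoot.mpr hS⟩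
  have hder : S.derivative.eval e = T.eval e := by
    rw [← hT, derivative_mul]
    simp
  have hev : ∀ z, S.eval z = (z - e) * T.eval z := fun z => by rw [← hT]; simp
  have hTne : ∀ z ∈ Set.Icc e x, T.eval z ≠ 0 := by
    intro z hz hz0
    rcases hz.1.eq_or_lt with rfl | hlt
    · exact hS' (hder.trans hz0)
    · exact hno z ⟨hlt, hz.2.trans hx.2⟩ (by rw [hev, hz0, mul_zero])
  have hpos := mul_eval_pos_of_forall_ne_zero hx.1.le hTne
  rw [hev, sign_mul, sign_pos (sub_pos.mpr hx.1), one_mul, hder]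
  exact (sign_eq_sign_of_mul_pos hpos).symm

/-- **Refinement endpoint rule, left side**: at a simple root `e` with no further root in `[t, e)`,
the sign of `S` on `[t, e)` is minus the sign of `S'(e)`. [cite: BasuPollackRoy2006, Prop. 2.21] -/
theorem sign_eval_eq_neg_sign_derivative_of_Ico {S : ℝ[X]} {e t : ℝ} (hS : S.IsRoot e)
    (hS' : S.derivative.eval e ≠ 0) (hno : ∀ z ∈ Set.Ico t e, S.eval z ≠ 0) {x : ℝ}
    (hx : x ∈ Set.Ico t e) : SignType.sign (S.eval x) = -SignType.sign (S.derivative.eval e) := by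
  obtain ⟨T, hT⟩ : ∃ T : ℝ[X], (X - C e) * T = S := ⟨_, mul_divByMonic_eq_iff_isRoot.mpr hS⟩
  have hder : S.derivative.eval e = T.eval e := by
    rw [← hT, derivative_mul]
    simp
  have hev : ∀ z, S.eval z = (z - e) * T.eval z := fun z => by rw [← hT]; simp
  have hTne : ∀ z ∈ Set.Icc x e, T.eval z ≠ 0 := by
    intro z hz hz0
    rcases hz.2.eq_or_lt with rfl | hlt
    · exact hS' (hder.trans hz0)
    · exact hno z ⟨hx.1.trans hz.1, hlt⟩ (by rw [hev, hz0, mul_zero])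
  have hpos := mul_eval_pos_of_forall_ne_zero hx.2.le hTne
  rw [hev, sign_mul, sign_neg (sub_neg.mpr hx.2), hder, sign_eq_sign_of_mul_pos hpos, neg_one_mul]

end Refinement

section SignCert

/-! ### `cap.roots.signcert`: no odd-multiplicity root in `(a,b)` ⇒ one weak sign on `[a,b]` -/

/-- **Soundness of `certify_sign_on_interval`**: if every root of `f` in the open interval `(a,b)`
has even multiplicity, then `f` does not change sign on `[a,b]`. [cite: BasuPollackRoy2006, Prop.
2.20, Prop. 2.21] -/
theorem mul_eval_nonneg_of_even_rootMultiplicity {f : ℝ[X]} {a b : ℝ}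
    (h : ∀ z ∈ Set.Ioo a b, f.IsRoot z → Even (f.rootMultiplicity z))
    {x y : ℝ} (hx : x ∈ Set.Icc a b) (hy : y ∈ Set.Icc a b) : 0 ≤ f.eval x * f.eval y := by
  induction hd : f.natDegree using Nat.strong_induction_on generalizing f x y with
  | _ d ih =>
    by_contra hneg
    rw [not_le] at hneg
    -- order the two points
    wlog hxy : x ≤ y generalizing x y
    · exact this hy hx (by rwa [mul_comm]) (le_of_not_ge hxy)
    have hf : f ≠ 0 := by rintro rfl; simp at hneg
    have hxy' : x < y :=
      lt_of_le_of_ne hxy (by rintro rfl; exact absurd hneg (not_lt.mpr (mul_self_nonneg _)))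
    -- a root strictly between x and y
    obtain ⟨z, hz, hz0⟩ : ∃ z ∈ Set.Ioo x y, f.eval z = 0 := by
      have hc : ContinuousOn (fun t => f.eval t) (Set.Icc x y) := f.continuous.continuousOn
      rcases mul_neg_iff.mp hneg with ⟨h1, h2⟩ | ⟨h1, h2⟩
      · obtain ⟨z, hz, hz0⟩ := intermediate_value_Icc' hxy hc ⟨h2.le, h1.le⟩
        refine ⟨z, ⟨lt_of_le_of_ne hz.1 ?_, lt_of_le_of_ne hz.2 ?_⟩, hz0⟩
        · rintro rfl; exact h1.ne' hz0
        · rintro rfl; exact h2.ne hz0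
      · obtain ⟨z, hz, hz0⟩ := intermediate_value_Icc hxy hc ⟨h1.le, h2.le⟩
        refine ⟨z, ⟨lt_of_le_of_ne hz.1 ?_, lt_of_le_of_ne hz.2 ?_⟩, hz0⟩
        · rintro rfl; exact h1.ne hz0
        · rintro rfl; exact h2.ne' hz0
    have hzab : z ∈ Set.Ioo a b := ⟨hx.1.trans_lt hz.1, hz.2.trans_le hy.2⟩
    obtain ⟨m, hm⟩ := h z hzab hz0
    -- factor f = (X - z)^(m+m) * g with g(z) ≠ 0
    have hfac := pow_mul_divByMonic_rootMultiplicity_eq f z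
    have hgz := eval_divByMonic_pow_rootMultiplicity_ne_zero z hf
    set n := f.rootMultiplicity z with hn
    set g := f /ₘ (X - C z) ^ n
    have hn0 : 0 < n := (rootMultiplicity_pos hf).mpr hz0
    have hg : g ≠ 0 := by rintro h'; rw [h'] at hgz; simp at hgz
    have hevf : ∀ t, f.eval t = (t - z) ^ n * g.eval t := fun t => by
      rw [← hfac]; simp
    -- g has smaller degree
    have hdeg : g.natDegree < d := by
      have := congr_arg natDegree hfac
      rw [natDegree_mul (pow_ne_zero _ (X_sub_C_ne_zero z)) hg, natDegree_pow, natDegree_X_sub_C,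
        mul_one, hd] at this
      omega
    -- g inherits the parity hypothesis
    have hg' : ∀ w ∈ Set.Ioo a b, g.IsRoot w → Even (g.rootMultiplicity w) := by
      intro w hw hw0
      have hwz : w ≠ z := by rintro rfl; exact hgz hw0
      have hfw : f.IsRoot w := by
        rw [IsRoot.def, hevf, hw0.eq_zero, mul_zero]
      have key : f.rootMultiplicity w = g.rootMultiplicity w := by
        conv_lhs => rw [← hfac]
        rw [rootMultiplicity_mul (hfac.symm ▸ hf), rootMultiplicity_eq_zero, zero_add]
        rw [IsRoot.def, eval_pow, eval_sub, eval_X, eval_C]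
        exact pow_ne_zero _ (sub_ne_zero.mpr hwz)
      rw [← key]
      exact h w hw hfw
    have hgxy := ih g.natDegree hdeg hg' hx hy rfl
    -- the even power is positive at x and y
    have hpow : 0 < (x - z) ^ n * (y - z) ^ n :=
      mul_pos (Even.pow_pos ⟨m, hm⟩ (sub_ne_zero.mpr hz.1.ne))
        (Even.pow_pos ⟨m, hm⟩ (sub_ne_zero.mpr hz.2.ne'))
    rw [hevf, hevf] at hneg
    have : (x - z) ^ n * g.eval x * ((y - z) ^ n * g.eval y)
        = ((x - z) ^ n * (y - z) ^ n) * (g.eval x * g.eval y) := by ring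
    rw [this] at hneg
    exact absurd (mul_nonneg hpow.le hgxy) (not_le.mpr hneg)

/-- **Completeness of `certify_sign_on_interval`**: an odd-multiplicity root `z ∈ (a,b)` makes `f`
change sign inside `(a,b)`. [cite: BasuPollackRoy2006, Prop. 2.20, Prop. 2.21] -/
theorem exists_mul_eval_neg_of_odd_rootMultiplicity {f : ℝ[X]} (hf : f ≠ 0) {a b z : ℝ}
    (hz : z ∈ Set.Ioo a b) (hodd : Odd (f.rootMultiplicity z)) :
    ∃ x ∈ Set.Ioo a b, ∃ y ∈ Set.Ioo a b, f.eval x * f.eval y < 0 := by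
  have hfac := pow_mul_divByMonic_rootMultiplicity_eq f z
  have hgz := eval_divByMonic_pow_rootMultiplicity_ne_zero z hf
  set n := f.rootMultiplicity z
  set g := f /ₘ (X - C z) ^ n
  have hevf : ∀ t, f.eval t = (t - z) ^ n * g.eval t := fun t => by
    rw [← hfac]; simp
  -- g has no zero near z
  obtain ⟨ε, hε, hεg⟩ : ∃ ε > 0, ∀ w, dist w z < ε → g.eval w ≠ 0 := by
    have hev : ∀ᶠ w in nhds z, g.eval w ≠ 0 :=
      g.continuous.continuousAt.eventually_ne hgz
    obtain ⟨ε, hε, hball⟩ := Metric.eventually_nhds_iff.mp hev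
    exact ⟨ε, hε, fun w hw => hball hw⟩
  set δ := min (ε / 2) (min ((z - a) / 2) ((b - z) / 2)) with hδ
  have hδ0 : 0 < δ := by
    rw [hδ]; refine lt_min (by linarith) (lt_min (by linarith [hz.1]) (by linarith [hz.2]))
  have hδε : δ < ε := by
    rw [hδ]; exact (min_le_left _ _).trans_lt (by linarith)
  have hδa : a < z - δ := by
    have : δ ≤ (z - a) / 2 := (min_le_right _ _).trans (min_le_left _ _)
    linarith [hz.1]
  have hδb : z + δ < b := by
    have : δ ≤ (b - z) / 2 := (min_le_right _ _).trans (min_le_right _ _)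
    linarith [hz.2]
  have hgne : ∀ w ∈ Set.Icc (z - δ) (z + δ), g.eval w ≠ 0 := by
    intro w hw
    apply hεg
    rw [Real.dist_eq, abs_lt]
    constructor <;> linarith [hw.1, hw.2]
  have hgpos := mul_eval_pos_of_forall_ne_zero (by linarith) hgne
  refine ⟨z - δ, ⟨hδa, by linarith [hz.2]⟩, z + δ, ⟨by linarith [hz.1], hδb⟩, ?_⟩
  rw [hevf, hevf]
  have e1 : z - δ - z = -δ := by ring
  have e2 : z + δ - z = δ := by ring
  rw [e1, e2, hodd.neg_pow]
  have : -δ ^ n * g.eval (z - δ) * (δ ^ n * g.eval (z + δ))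
      = -((δ ^ n * δ ^ n) * (g.eval (z - δ) * g.eval (z + δ))) := by ring
  rw [this, neg_lt_zero]
  exact mul_pos (mul_pos (pow_pos hδ0 _) (pow_pos hδ0 _)) hgpos

end SignCert

section Schoenberg

open Literature.Analysis.TotalPositivity

/-! ### Consequences of Schoenberg's sector theorem: BPR Prop. 2.39 and Prop. 2.44 -/

/-- **BPR Prop 2.39 (via Schoenberg, `m = 1`)**: a real polynomial all of whose complex roots have
non-positive real part has no sign variation. [cite: BasuPollackRoy2006, Prop. 2.39] -/
theorem signVariations_eq_zero_of_roots_re_nonpos {f : ℝ[X]}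
    (h : ∀ z : ℂ, aeval z f = 0 → z.re ≤ 0) : f.signVariations = 0 := by
  by_cases hf : f = 0
  · simp [hf]
  have hfac := pow_mul_divByMonic_rootMultiplicity_eq f 0
  have hev := eval_divByMonic_pow_rootMultiplicity_ne_zero 0 hf
  set k := rootMultiplicity 0 f
  set g := f /ₘ (X - C 0) ^ k
  simp only [map_zero, sub_zero] at hfac hev
  set s := g.eval 0 with hs
  have hs0 : s ≠ 0 := hev
  set g' := C s * g with hg'
  have hV : f.signVariations = g'.signVariations := by
    rw [← hfac, signVariations_X_pow_mul, hg', signVariations_C_mul _ hs0]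
  have hroots : ∀ z : ℂ, aeval z g' = 0 → z.re ≤ 0 := by
    intro z hz
    apply h
    rw [← hfac, map_mul, map_pow, aeval_X]
    rw [hg', map_mul, aeval_C, mul_eq_zero] at hz
    rcases hz with hz | hz
    · exact absurd (by simpa using hz) hs0
    · rw [hz, mul_zero]
  have hcoeff0 : 0 < g'.coeff 0 := by
    rw [hg', coeff_C_mul, coeff_zero_eq_eval_zero, ← hs]
    exact mul_self_pos.mpr hs0
  have hPF := schoenberg_sector_pf_holds 1 g' hcoeff0 (by
    intro z hz hz0
    have hz' : |z.arg| < Real.pi / 2 := by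
      convert hz using 1; push_cast; ring
    rcases Complex.abs_arg_lt_pi_div_two_iff.mp hz' with hre | rfl
    · exact absurd (hroots z hz0) (not_le.mpr hre)
    · rw [← coeff_zero_eq_aeval_zero'] at hz0
      simp only [Complex.coe_algebraMap, Complex.ofReal_eq_zero] at hz0
      exact hcoeff0.ne' hz0)
  rw [hV]
  exact signVariations_eq_zero_of_coeff_nonneg (isMultiplyPositiveSeq_one_iff.mp hPF)

/-- A strictly increasing pair. [folklore] -/
private theorem strictMono_pair {p q : ℕ} (hpq : p < q) : StrictMono ![p, q] := by
  rw [strictMono_vecCons]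
  refine ⟨by simpa using hpq, fun i j hij => ?_⟩
  have hij' : i = j := Subsingleton.elim (α := Fin 1) i j
  exact absurd hij (hij' ▸ lt_irrefl _)

/-- The `2 × 2` Toeplitz minors used in Obreschkoff's lemma: `a_h a_{l+1} ≤ a_{h+1} a_l` for `h <
l`, for a `PF₂` sequence. [folklore] -/
private theorem pf2_mul_le_mul {a : ℕ → ℝ} (h2 : IsMultiplyPositiveSeq 2 a)
    {h l : ℕ} (hhl : h < l) : a h * a (l + 1) ≤ a (h + 1) * a l := by
  have := h2 2 le_rfl ![h + 1, l + 1] ![0, 1] (strictMono_pair (by omega))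
    (strictMono_pair zero_lt_one)
  rw [toeplitzMinor, Matrix.det_fin_two] at this
  simp only [Matrix.of_apply, Matrix.cons_val_zero, Matrix.cons_val_one,
    Nat.cast_zero, sub_zero, Nat.cast_one, Nat.cast_add, add_sub_cancel_right,
    seqZ_natCast] at this
  have e1 : ((h : ℤ) + 1) = ((h + 1 : ℕ) : ℤ) := by push_cast; ring
  have e2 : ((l : ℤ) + 1) = ((l + 1 : ℕ) : ℤ) := by push_cast; ring
  rw [e1, e2, seqZ_natCast, seqZ_natCast] at this
  linarith

/-- **Obreschkoff's lemma in `PF₂` form** (BPR Lemma 2.43 / Prop 2.44): for `g` with positive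
constant term and twice-positive coefficient sequence, and `y > 0`, `Var((X - y)·g) = 1`. [cite:
BasuPollackRoy2006, Lemma 2.43, Prop. 2.44] -/
theorem signVariations_X_sub_C_mul_eq_one_of_pf2 {g : ℝ[X]} (hg0 : 0 < g.coeff 0)
    (hPF : IsMultiplyPositiveSeq 2 (fun n => g.coeff n)) {y : ℝ} (hy : 0 < y) :
    ((X - C y) * g).signVariations = 1 := by
  have hnn : ∀ n, 0 ≤ g.coeff n := fun n => hPF.nonneg (by norm_num) n
  set b : ℝ[X] := (X - C y) * g with hb
  have hb0 : b.coeff 0 = -(y * g.coeff 0) := by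
    rw [hb, sub_mul, coeff_sub, coeff_X_mul_zero, coeff_C_mul, zero_sub]
  have hbs : ∀ k, b.coeff (k + 1) = g.coeff k - y * g.coeff (k + 1) := fun k => by
    rw [hb, sub_mul, coeff_sub, coeff_X_mul, coeff_C_mul]
  -- no `+` before a `-`
  have key : ∀ i j, i < j → 0 < b.coeff i → ¬ b.coeff j < 0 := by
    intro i j hij hi hj
    obtain ⟨h, rfl⟩ : ∃ h, i = h + 1 := by
      rcases i with _ | h
      · rw [hb0] at hi; exact absurd hi (not_lt.mpr (neg_nonpos.mpr (by positivity)))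
      · exact ⟨h, rfl⟩
    obtain ⟨l, rfl⟩ : ∃ l, j = l + 1 := ⟨j - 1, by omega⟩
    rw [hbs] at hi hj
    have hhl : h < l := by omega
    have hmin := pf2_mul_le_mul hPF hhl
    -- a_h > y a_{h+1} ≥ 0 and a_{l+1} > a_l / y ≥ 0
    have h1 : y * g.coeff (h + 1) < g.coeff h := by linarith
    have h2 : g.coeff l < y * g.coeff (l + 1) := by linarith
    have h3 : y * g.coeff (h + 1) * g.coeff l ≤ y * (g.coeff h * g.coeff (l + 1)) := by
      nlinarith [hnn (h+1), hnn l, hnn h, hnn (l+1)]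
    nlinarith [hnn (h+1), hnn l, hnn h, hnn (l+1), mul_nonneg hy.le (hnn (h + 1))]
  -- threshold: the first index with a positive coefficient
  classical
  have hgne : g ≠ 0 := by rintro rfl; simp at hg0
  have hbne : b ≠ 0 := mul_ne_zero (X_sub_C_ne_zero y) hgne
  have hlead : 0 < b.leadingCoeff := by
    rw [hb, leadingCoeff_mul, leadingCoeff_X_sub_C, one_mul]
    exact lt_of_le_of_ne (hnn _) (Ne.symm (leadingCoeff_ne_zero.mpr hgne))
  have hex : ∃ m, 0 < b.coeff m := ⟨b.natDegree, hlead⟩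
  let m := Nat.find hex
  have hm : 0 < b.coeff m := Nat.find_spec hex
  refine signVariations_eq_one_of_pattern m (fun k hk => not_lt.mp (Nat.find_min hex hk))
    (fun k hk => ?_) ⟨0, by rw [hb0]; exact neg_neg_of_pos (mul_pos hy hg0)⟩ hex
  by_contra hneg
  rw [not_le] at hneg
  rcases hk.eq_or_lt with rfl | hlt
  · exact absurd hm (not_lt.mpr hneg.le)
  · exact key m k hlt hm hneg

/-- In the closed cone `B = {|Im z| ≤ -√3 Re z}` a non-zero point has `|arg z| ≥ 2π/3`. [folklore]
-/
private theorem two_pi_div_three_le_abs_arg {z : ℂ} (hz : z ≠ 0) (hB : |z.im| ≤ -√3 * z.re) :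
    2 * Real.pi / 3 ≤ |z.arg| := by
  by_contra hlt
  rw [not_le] at hlt
  have h3pos : (0 : ℝ) < Real.sqrt 3 := Real.sqrt_pos.mpr (by norm_num)
  have hre : z.re ≤ 0 := by
    by_contra hpos
    rw [not_le] at hpos
    have := mul_pos h3pos hpos
    linarith [abs_nonneg z.im]
  have him : z.im ^ 2 ≤ 3 * z.re ^ 2 := by
    have h3 : Real.sqrt 3 ^ 2 = 3 := Real.sq_sqrt (by norm_num)
    have hB' : |z.im| ≤ Real.sqrt 3 * (-z.re) := by linarith
    nlinarith [abs_nonneg z.im, sq_abs z.im, Real.sqrt_nonneg 3]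
  have hnorm : ‖z‖ ≤ -2 * z.re := by
    rw [Complex.norm_def, Real.sqrt_le_iff]
    refine ⟨by linarith, ?_⟩
    rw [Complex.normSq_apply]
    nlinarith
  have hcos : Real.cos (2 * Real.pi / 3) < Real.cos (|z.arg|) :=
    Real.cos_lt_cos_of_nonneg_of_le_pi (abs_nonneg _) (by linarith [Real.pi_pos]) hlt
  rw [Real.cos_abs, Complex.cos_arg hz, show 2 * Real.pi / 3 = Real.pi - Real.pi / 3 by ring,
    Real.cos_pi_sub, Real.cos_pi_div_three] at hcos
  have hn : 0 < ‖z‖ := norm_pos_iff.mpr hz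
  rw [lt_div_iff₀ hn] at hcos
  linarith

/-- **Obreschkoff–Schoenberg** (BPR Prop 2.44, via Schoenberg `m = 2`): `f ≠ 0` with all complex
roots in the closed cone `B`, `y > 0` ⇒ `Var((X - y)·f) = 1`. [cite: BasuPollackRoy2006, Prop. 2.40,
Prop. 2.44] -/
theorem signVariations_X_sub_C_mul_eq_one_of_roots_in_cone {f : ℝ[X]} (hf : f ≠ 0) {y : ℝ}
    (hy : 0 < y) (h : ∀ z : ℂ, aeval z f = 0 → |z.im| ≤ -√3 * z.re) :
    ((X - C y) * f).signVariations = 1 := by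
  have hfac := pow_mul_divByMonic_rootMultiplicity_eq f 0
  have hev := eval_divByMonic_pow_rootMultiplicity_ne_zero 0 hf
  set k := rootMultiplicity 0 f
  set g := f /ₘ (X - C 0) ^ k
  simp only [map_zero, sub_zero] at hfac hev
  set s := g.eval 0 with hs
  have hs0 : s ≠ 0 := hev
  set g' := C s * g with hg'
  have hV : ((X - C y) * f).signVariations = ((X - C y) * g').signVariations := by
    rw [← hfac, mul_left_comm, signVariations_X_pow_mul, hg', mul_left_comm,
      signVariations_C_mul _ hs0]
  have hroots : ∀ z : ℂ, aeval z g' = 0 → |z.im| ≤ -√3 * z.re := by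
    intro z hz
    apply h
    rw [← hfac, map_mul, map_pow, aeval_X]
    rw [hg', map_mul, aeval_C, mul_eq_zero] at hz
    rcases hz with hz | hz
    · exact absurd (by simpa using hz) hs0
    · rw [hz, mul_zero]
  have hcoeff0 : 0 < g'.coeff 0 := by
    rw [hg', coeff_C_mul, coeff_zero_eq_eval_zero, ← hs]
    exact mul_self_pos.mpr hs0
  have hPF := schoenberg_sector_pf_holds 2 g' hcoeff0 (by
    intro z hz hz0
    have hz' : |z.arg| < 2 * Real.pi / 3 := by
      convert hz using 1; push_cast; ring
    by_cases hzz : z = 0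
    · subst hzz
      rw [← coeff_zero_eq_aeval_zero'] at hz0
      simp only [Complex.coe_algebraMap, Complex.ofReal_eq_zero] at hz0
      exact hcoeff0.ne' hz0
    · exact absurd (two_pi_div_three_le_abs_arg hzz (hroots z hz0)) (not_le.mpr hz'))
  rw [hV]
  exact signVariations_X_sub_C_mul_eq_one_of_pf2 hcoeff0 hPF hy

end Schoenberg

/-- For a square-free real polynomial every root is simple (cap isolates the roots of the
square-free part). [cite: BasuPollackRoy2006, Algorithm 10.4 (separable part)] -/
theorem rootMultiplicity_eq_one_of_squarefree {P : ℝ[X]} (hsq : Squarefree P) {a : ℝ}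
    (ha : P.IsRoot a) : P.rootMultiplicity a = 1 :=
  le_antisymm
    (rootMultiplicity_le_one_of_separable (PerfectField.separable_iff_squarefree.mpr hsq) a)
    ((rootMultiplicity_pos hsq.ne_zero).mpr ha)

end Literature.Algebra.Polynomial.Descartes
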